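import Summits.QuantumAdvantage.QuantumAdvantage.Theorems.CubicForrelationNearExactIsExactKtGapOrder

/-!
# Crux `CubicForrelation.NearExactIsExact` (stmt-QuantumAdvantage-14043) — EVERY `n = 2m ≥ 6`: the three top candidate values of a cubic pair with
  a BENT side, and the gap below them

Certificate seat `b2b-cforr-cert` (gen 45).  HONEST FRAMING: a kernel-checked theorem UNIFORM in `n` (standard axioms, no certificates) — the
Lean shadow of the reduction step of DISPROOF.md §18 (THEOREM BENT): for cubic `f, g : 𝔽₂^{2m} → 𝔽₂` with `g` bent and `m ≥ 3`, writing
`r₀ = ⌊(m+3)/2⌋` (Hou's bound on the degree of the dual `g̃`, `stub_houCubic`),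
  `Φ(f,g) ∈ {1, 1 − 2/2^{r₀}, 1 − 3/2^{r₀}} ∪ (−∞, 1 − 7/2^{r₀+1}]`   (`fo_bent_values_all`).
Indeed `Φ = 1 − 2·#{f ≠ g̃}/2^{2m}` (`bb_forrelation_eq_of_dual`) and `f ⊕ g̃` is a word of `RM(r₀, 2m)`, whose weights below `1.75·d_min` are
`0, d_min, 1.5·d_min` (`rm_weights_below_seven_quarters_order` = second weight + the every-order Kasami–Tokura gap `kt_gap_order` of this
generation).  At `n = 14, 18, 22` the middle values are dead (gens 9/44: `fo_bent_false`, `fo_bent_ne_29_32`, `fo18_bent_ne_61_64`,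
`fo22_bent_ne_125_128`), see …BentFourteenFiftySevenSixtyFourths / …BentEighteenTwentyTwoGap.  NOT summit progress: nothing here bounds the crux's
uniform `θ` (the bound `1 − 7/2^{r₀+1}` tends to `1`).

References: O. S. Rothaus (1976); X.-D. Hou (1998); T. Kasami, N. Tokura (1970) Thm 1; DISPROOF.md §18.2.  Axioms: the standard three.
-/

set_option linter.dupNamespace false -- D-0017: single-problem summit ⇒ `QuantumAdvantage.QuantumAdvantage` by design

noncomputable section

namespace Summit.QuantumAdvantage.QuantumAdvantage.Theorems.CubicForrelation.NearExactIsExact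

open Finset
open Literature.Computability.QuantumComplexity
open Literature.Computability.QuantumComplexity.DerivativeWalsh (W)

/-- **The bent side, every `n = 2m ≥ 6`: weights.**  For cubic `f, g : 𝔽₂^{2m} → 𝔽₂` (`m ≥ 3`) with `W_g = 2^m (−1)^d`: the distance
`N = #{f ≠ d}` satisfies `N = 0`, `2^{r₀} N = 2^{2m}`, `2^{r₀+1} N = 3·2^{2m}` or `7·2^{2m} ≤ 2^{r₀+2} N`, `r₀ = ⌊(m+3)/2⌋`.
NOT summit progress. [this work] -/
theorem fo_bent_dist_values_all (m : ℕ) (hm : 3 ≤ m) (f g d : (Fin (m + m) → Bool) → Bool) (hf : IsDegLeFun 3 f) (hg : IsDegLeFun 3 g)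
    (hd : ∀ x, W (fun y => signOf (g y)) x = (2 : ℝ) ^ m * signOf (d x)) :
    #(univ.filter fun x => f x ≠ d x) = 0 ∨ 2 ^ ((m + 3) / 2) * #(univ.filter fun x => f x ≠ d x) = 2 ^ (m + m) ∨
      2 ^ ((m + 3) / 2 + 1) * #(univ.filter fun x => f x ≠ d x) = 3 * 2 ^ (m + m) ∨
      7 * 2 ^ (m + m) ≤ 2 ^ ((m + 3) / 2 + 2) * #(univ.filter fun x => f x ≠ d x) := by
  classical
  have hdeg : IsDegLeFun ((m + 3) / 2) d := stub_houCubic stub_axParity m g d hg hd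
  have hr : 2 ≤ (m + 3) / 2 := by omega
  have h3 : 3 ≤ (m + 3) / 2 := by omega
  have he : IsDegLeFun ((m + 3) / 2) (fun x => f x ^^ d x) := bb_isDegLeFun_bxor (hf.mono h3) hdeg
  rw [← bb_filter_bxor_eq]
  by_cases hlt : 2 ^ ((m + 3) / 2 + 2) * #(univ.filter fun x => (f x ^^ d x) = true) < 7 * 2 ^ (m + m)
  · rcases rm_weights_below_seven_quarters_order hr _ he hlt with h | h | h
    · exact Or.inl h
    · exact Or.inr (Or.inl h)
    · exact Or.inr (Or.inr (Or.inl h))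
  · exact Or.inr (Or.inr (Or.inr (not_lt.1 hlt)))

/-- **The bent side, every `n = 2m ≥ 6`: values.**  For cubic `f, g : 𝔽₂^{2m} → 𝔽₂` (`m ≥ 3`) with `g` bent (`W_g² ≡ 2^{2m}`) and
`r₀ = ⌊(m+3)/2⌋`: `Φ(f,g) = 1`, or `Φ(f,g) = 1 − 2/2^{r₀}` (minimum-weight line), or `Φ(f,g) = 1 − 3/2^{r₀}` (Kasami–Tokura `1.5·d` line), or
`Φ(f,g) ≤ 1 − 7/2^{r₀+1}`.  (`n = 14`: `1, 15/16, 29/32, ≤ 57/64`; `n = 18`: `1, 31/32, 61/64, ≤ 121/128`; `n = 22`: `1, 63/64, 125/128, ≤ 249/256`.)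
Uniform in `n`; NOT summit progress. [this work] -/
theorem fo_bent_values_all (m : ℕ) (hm : 3 ≤ m) (f g : (Fin (m + m) → Bool) → Bool) (hf : IsDegLeFun 3 f) (hg : IsDegLeFun 3 g)
    (hbent : ∀ x, W (fun y => signOf (g y)) x ^ 2 = (2 : ℝ) ^ (m + m)) :
    forrelation f g = 1 ∨ forrelation f g = 1 - 2 / 2 ^ ((m + 3) / 2) ∨ forrelation f g = 1 - 3 / 2 ^ ((m + 3) / 2) ∨
      forrelation f g ≤ 1 - 7 / 2 ^ ((m + 3) / 2 + 1) := by
  classical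
  obtain ⟨d, hd⟩ := bb_exists_dual hbent
  have hΦ := bb_forrelation_eq_of_dual f g d hd
  have hP : (0 : ℝ) < 2 ^ ((m + 3) / 2) := by positivity
  have hQ : (0 : ℝ) < 2 ^ (m + m) := by positivity
  have hP1 : (2 : ℝ) ^ ((m + 3) / 2 + 1) = 2 * 2 ^ ((m + 3) / 2) := by ring
  have hP2 : (2 : ℝ) ^ ((m + 3) / 2 + 2) = 4 * 2 ^ ((m + 3) / 2) := by ring
  rcases fo_bent_dist_values_all m hm f g d hf hg hd with h | h | h | h
  · left
    rw [hΦ, h]; simp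
  · right; left
    have e : (2 : ℝ) ^ ((m + 3) / 2) * (#(univ.filter fun x => f x ≠ d x) : ℝ) = 2 ^ (m + m) := by exact_mod_cast h
    have hN : (#(univ.filter fun x => f x ≠ d x) : ℝ) = 2 ^ (m + m) / 2 ^ ((m + 3) / 2) := by
      rw [eq_div_iff hP.ne']; linarith
    rw [hΦ, hN]; field_simp
  · right; right; left
    have e : (2 : ℝ) ^ ((m + 3) / 2 + 1) * (#(univ.filter fun x => f x ≠ d x) : ℝ) = 3 * 2 ^ (m + m) := by exact_mod_cast h
    rw [hP1] at e
    have hN : (#(univ.filter fun x => f x ≠ d x) : ℝ) = 3 * 2 ^ (m + m) / (2 * 2 ^ ((m + 3) / 2)) := by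
      rw [eq_div_iff (by positivity)]; linarith
    rw [hΦ, hN]; field_simp
  · right; right; right
    have e : 7 * (2 : ℝ) ^ (m + m) ≤ 2 ^ ((m + 3) / 2 + 2) * (#(univ.filter fun x => f x ≠ d x) : ℝ) := by exact_mod_cast h
    rw [hP2] at e
    rw [hΦ, hP1]
    -- `1 − 2N/Q ≤ 1 − 7/(2P)` iff `7/(2P) ≤ 2N/Q` iff `7Q ≤ 4PN`
    have key : 7 / (2 * (2 : ℝ) ^ ((m + 3) / 2)) ≤ 2 * (#(univ.filter fun x => f x ≠ d x) : ℝ) / 2 ^ (m + m) := by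
      rw [div_le_div_iff₀ (by positivity) hQ]; linarith
    linarith

end Summit.QuantumAdvantage.QuantumAdvantage.Theorems.CubicForrelation.NearExactIsExact

end
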